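import Mathlib.Analysis.Calculus.MeanValue
import Mathlib.Analysis.Calculus.Deriv.Inv
import Mathlib.Analysis.InnerProductSpace.Calculus

/-!
# Handoff (rh-explicit, prove-1), Route E: the Riccati barrier (LEMMA R of handoff/prove-1 ATTEMPT-13 §9.1)

The ONE analytic device behind the explicit form of LEMMA G_m (the c-uniform lower bound for the
Mellin-point Gram constant of the Sonine seed family, ATTEMPT-13 §9): a comparison ("fencing")
principle for the modulus of a complex-valued solution of a Riccati-type equation

  `w' = -(L + w)·w - res`,   `Re L ≥ λ`,   `‖res‖ ≤ ρ`,

on a half-line `[c₁, ∞)`: if a positive differentiable barrier `h` satisfies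
`-λ·h + h² + ρ < h'` and `‖w(c₁)‖ ≤ h(c₁)`, then `‖w(c)‖ ≤ h(c)` for all `c ≥ c₁`.
In the application `w = u'/u - V_K` is the deviation of the logarithmic derivative of
`u(c) = ₀F₁(;b;c²/4)` from the `K`-term formal (Riccati) solution, `L = 2β/c + 2V_K`, `res` the
explicit residual polynomial, and `h(c) = A·c^{-(K+1)}`; the hypothesis at `c₁` is a single evaluation of
a convergent series. The proof is Mathlib's fencing theorem
`image_le_of_deriv_right_lt_deriv_boundary'` applied to `‖w‖²` against `h²`, with the derivative
`(‖w‖²)' = 2⟪w, w'⟫_ℝ = 2·Re(w'·conj w)` and the pointwise estimate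
`Re((-(L+w)w - res)·conj w) ≤ (‖w‖ - λ)‖w‖² + ρ‖w‖`.
Nothing here bears on RH (an ODE comparison lemma). [folklore: the method of differential inequalities /
barriers; the Mathlib fencing theorem is the whole proof]
-/

set_option linter.dupNamespace false

noncomputable section

open Set Complex

namespace Summit.RiemannHypothesis.RiemannHypothesis.Theorems.HandoffRiccatiBarrier

open scoped ComplexConjugate InnerProductSpace

/-- Pointwise estimate for the Riccati right-hand side paired with `conj w`:
`Re((-(ℓ + z)·z - r)·conj z) ≤ (‖z‖ - λ)·‖z‖² + ρ·‖z‖` when `λ ≤ Re ℓ`, `‖r‖ ≤ ρ`. [elementary] -/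
theorem re_rhs_mul_conj_le (z ℓ r : ℂ) {lam ρ : ℝ} (hℓ : lam ≤ ℓ.re) (hr : ‖r‖ ≤ ρ) :
    ((-(ℓ + z) * z - r) * conj z).re ≤ (‖z‖ - lam) * ‖z‖ ^ 2 + ρ * ‖z‖ := by
  have hzz : z * conj z = ((‖z‖ : ℂ) ^ 2) := Complex.mul_conj' z
  have hsplit : (-(ℓ + z) * z - r) * conj z = -(ℓ + z) * ((‖z‖ : ℂ) ^ 2) - r * conj z := by
    rw [← hzz]; ring
  have hA : (-(ℓ + z) * ((‖z‖ : ℂ) ^ 2)).re = -(ℓ.re + z.re) * ‖z‖ ^ 2 := by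
    rw [← Complex.ofReal_pow, Complex.re_mul_ofReal]
    simp only [Complex.neg_re, Complex.add_re]
  have hB : -(ρ * ‖z‖) ≤ (r * conj z).re := by
    have h1 : |(r * conj z).re| ≤ ‖r * conj z‖ := Complex.abs_re_le_norm _
    have h2 : ‖r * conj z‖ ≤ ρ * ‖z‖ := by
      rw [norm_mul, Complex.norm_conj]
      exact mul_le_mul_of_nonneg_right hr (norm_nonneg _)
    have := (abs_le.1 (h1.trans h2)).1
    linarith
  have hC : -‖z‖ ≤ z.re := (abs_le.1 (Complex.abs_re_le_norm z)).1
  have hD : (lam - ‖z‖) * ‖z‖ ^ 2 ≤ (ℓ.re + z.re) * ‖z‖ ^ 2 :=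
    mul_le_mul_of_nonneg_right (by linarith) (sq_nonneg _)
  rw [hsplit, Complex.sub_re, hA]
  linarith

/-- **LEMMA R (Riccati barrier), general form.** Let `w` solve `w' = -(L + w)·w - res` on `[c₁, ∞)`
with `Re L ≥ λ` and `‖res‖ ≤ ρ` there, and let `h > 0` be differentiable with `-λ·h + h² + ρ < h'` on
`[c₁, ∞)`. If `‖w(c₁)‖ ≤ h(c₁)` then `‖w(c)‖ ≤ h(c)` for every `c ≥ c₁`.
(The linearisation `w' ≈ -L w` is forward-stable, so a barrier crossed nowhere is never reached.)
[folklore: comparison principle via Mathlib `image_le_of_deriv_right_lt_deriv_boundary'`] -/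
theorem norm_le_barrier {w res L : ℝ → ℂ} {h h' ρ : ℝ → ℝ} {c₁ lam : ℝ}
    (hw : ∀ c, c₁ ≤ c → HasDerivAt w (-(L c + w c) * w c - res c) c)
    (hL : ∀ c, c₁ ≤ c → lam ≤ (L c).re) (hres : ∀ c, c₁ ≤ c → ‖res c‖ ≤ ρ c)
    (hh : ∀ c, c₁ ≤ c → HasDerivAt h (h' c) c) (hpos : ∀ c, c₁ ≤ c → 0 < h c)
    (hbar : ∀ c, c₁ ≤ c → -lam * h c + h c ^ 2 + ρ c < h' c) (h0 : ‖w c₁‖ ≤ h c₁) :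
    ∀ c, c₁ ≤ c → ‖w c‖ ≤ h c := by
  intro c hc
  have key := image_le_of_deriv_right_lt_deriv_boundary'
    (f := fun x => ‖w x‖ ^ 2) (f' := fun x => 2 * ⟪w x, -(L x + w x) * w x - res x⟫_ℝ)
    (a := c₁) (b := c) (B := fun x => h x ^ 2) (B' := fun x => 2 * h x * h' x)
    (fun x hx => (((hw x hx.1).continuousAt.norm).pow 2).continuousWithinAt)
    (fun x hx => ((hw x hx.1).norm_sq).hasDerivWithinAt)
    (pow_le_pow_left₀ (norm_nonneg _) h0 2)
    (fun x hx => (((hh x hx.1).continuousAt).pow 2).continuousWithinAt)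
    (fun x hx => by
      have := (hh x hx.1).pow 2
      simp only [Nat.cast_ofNat, Nat.add_one_sub_one, pow_one] at this
      exact this.hasDerivWithinAt)
    (fun x hx heq => by
      have hp := hpos x hx.1
      have hη : ‖w x‖ = h x := by
        have := (sq_eq_sq₀ (norm_nonneg (w x)) hp.le).1 heq
        exact this
      have hre : ⟪w x, -(L x + w x) * w x - res x⟫_ℝ
          = ((-(L x + w x) * w x - res x) * conj (w x)).re := Complex.inner _ _
      have hle := re_rhs_mul_conj_le (w x) (L x) (res x) (hL x hx.1) (hres x hx.1)
      have hb := hbar x hx.1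
      rw [hre, hη] at *
      have : (h x - lam) * h x ^ 2 + ρ x * h x < h x * h' x := by nlinarith
      show 2 * ((-(L x + w x) * w x - res x) * conj (w x)).re < 2 * h x * h' x
      linarith)
  have h2 : ‖w c‖ ^ 2 ≤ h c ^ 2 := key ⟨hc, le_rfl⟩
  exact (pow_le_pow_iff_left₀ (norm_nonneg _) (hpos c hc).le two_ne_zero).1 h2

/-- **LEMMA R, power-barrier form** (the form used in ATTEMPT-13 §9.1). With the residual bound
`‖res(c)‖ ≤ R̄/c^{K+1}`, `Re L ≥ λ > 0` and `A := 2R̄/λ`, the single numerical condition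
`2(K+1)/(λc₁) + 4R̄/(λ²c₁^{K+1}) < 1` at the left end point (its left side decreases in `c`) makes
`h(c) = A/c^{K+1}` a barrier on `[c₁, ∞)`: `‖w(c₁)‖ ≤ A/c₁^{K+1}` propagates to every `c ≥ c₁`.
[folklore; ATTEMPT-13 §9.1] -/
theorem norm_le_pow_barrier {w res L : ℝ → ℂ} {c₁ lam Rbar : ℝ} {K : ℕ}
    (hc₁ : 0 < c₁) (hlam : 0 < lam) (hR : 0 < Rbar)
    (hw : ∀ c, c₁ ≤ c → HasDerivAt w (-(L c + w c) * w c - res c) c)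
    (hL : ∀ c, c₁ ≤ c → lam ≤ (L c).re)
    (hres : ∀ c, c₁ ≤ c → ‖res c‖ ≤ Rbar / c ^ (K + 1))
    (hcond : 2 * (K + 1) / (lam * c₁) + 4 * Rbar / (lam ^ 2 * c₁ ^ (K + 1)) < 1)
    (h0 : ‖w c₁‖ ≤ 2 * Rbar / lam / c₁ ^ (K + 1)) :
    ∀ c, c₁ ≤ c → ‖w c‖ ≤ 2 * Rbar / lam / c ^ (K + 1) := by
  set A : ℝ := 2 * Rbar / lam with hA
  have hA0 : 0 < A := by rw [hA]; positivity
  have hl : lam ≠ 0 := hlam.ne'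
  -- the barrier, its derivative and the residual majorant
  set h : ℝ → ℝ := fun x => A / x ^ (K + 1) with hh
  set h' : ℝ → ℝ := fun x => A * (-((↑(K + 1) : ℝ) * x ^ K) / (x ^ (K + 1)) ^ 2) with hh'
  set ρ : ℝ → ℝ := fun x => Rbar / x ^ (K + 1) with hρ
  have hderiv : ∀ c, c₁ ≤ c → HasDerivAt h (h' c) c := by
    intro c hc
    have hc0 : c ≠ 0 := (hc₁.trans_le hc).ne'
    have hpow : HasDerivAt (fun x : ℝ => x ^ (K + 1)) (((K + 1 : ℕ) : ℝ) * c ^ K) c := by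
      simpa using hasDerivAt_pow (K + 1) c
    have h1 := (hpow.inv (pow_ne_zero _ hc0)).const_mul A
    have h2 : HasDerivAt (fun y : ℝ => A * (y ^ (K + 1))⁻¹)
        (A * (-(((K + 1 : ℕ) : ℝ) * c ^ K) / (c ^ (K + 1)) ^ 2)) c := by
      simpa only [Pi.inv_apply] using h1
    have hfun : h = fun x => A * (x ^ (K + 1))⁻¹ := by
      funext x; simp only [hh, div_eq_mul_inv]
    rw [hfun]
    exact h2
  have hposh : ∀ c, c₁ ≤ c → 0 < h c := fun c hc => by
    have : 0 < c := hc₁.trans_le hc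
    simp only [hh]; positivity
  -- the barrier inequality from the single condition at c₁
  have hbar : ∀ c, c₁ ≤ c → -lam * h c + h c ^ 2 + ρ c < h' c := by
    intro c hc
    have hc0 : 0 < c := hc₁.trans_le hc
    have hP : 0 < c ^ (K + 1) := pow_pos hc0 _
    -- the condition at c (monotone in c)
    have hcond_c : 2 * (K + 1) / (lam * c) + 4 * Rbar / (lam ^ 2 * c ^ (K + 1)) < 1 := by
      have t1 : 2 * (K + 1) / (lam * c) ≤ 2 * (K + 1) / (lam * c₁) := by
        apply div_le_div_of_nonneg_left (by positivity) (by positivity)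
        exact mul_le_mul_of_nonneg_left hc hlam.le
      have t2 : 4 * Rbar / (lam ^ 2 * c ^ (K + 1)) ≤ 4 * Rbar / (lam ^ 2 * c₁ ^ (K + 1)) := by
        apply div_le_div_of_nonneg_left (by positivity) (by positivity)
        exact mul_le_mul_of_nonneg_left (pow_le_pow_left₀ hc₁.le hc _) (sq_nonneg _)
      linarith
    have key : A ^ 2 + A * (K + 1) * c ^ K < Rbar * c ^ (K + 1) := by
      have e1 : (2 * (K + 1) / (lam * c) + 4 * Rbar / (lam ^ 2 * c ^ (K + 1))) * (Rbar * c ^ (K + 1))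
          = A * (K + 1) * c ^ K + A ^ 2 := by
        rw [hA]; field_simp; ring
      have := mul_lt_mul_of_pos_right hcond_c (by positivity : (0 : ℝ) < Rbar * c ^ (K + 1))
      rw [e1, one_mul] at this
      linarith
    have e2 : -lam * h c + h c ^ 2 + ρ c - h' c
        = (A ^ 2 + A * (K + 1) * c ^ K - Rbar * c ^ (K + 1)) / (c ^ (K + 1)) ^ 2 := by
      simp only [hh, hh', hρ, hA, Nat.cast_add, Nat.cast_one]
      field_simp
      ring
    have : -lam * h c + h c ^ 2 + ρ c - h' c < 0 := by
      rw [e2]; exact div_neg_of_neg_of_pos (by linarith) (by positivity)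
    linarith
  have hres' : ∀ c, c₁ ≤ c → ‖res c‖ ≤ ρ c := fun c hc => by simp only [hρ]; exact hres c hc
  have h0' : ‖w c₁‖ ≤ h c₁ := by simp only [hh, hA]; exact h0
  intro c hc
  have := norm_le_barrier hw hL hres' hderiv hposh hbar h0' c hc
  simp only [hh, hA] at this
  exact this

end Summit.RiemannHypothesis.RiemannHypothesis.Theorems.HandoffRiccatiBarrier
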